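import Summits.MatrixMultiplication.OmegaCensus.STPPSmallPatternKernelReflect122S

/-!
# ω-census, small STPP pattern `(1,2,2)^k`: reflection with the `B ↔ C` DUALITY (plus automorphism/stabiliser reductions)

HONEST FRAMING (pub-omega census; verbatim): lottery ticket; floor = certified bounds/negative ranges.
Census STRUCTURE bookkeeping of the STPP track (seat pub-omega-stpp-3, gen 24; STRUCTURE row B5, column `T2`), not progress on `ω`.

The `(1,2,2)` difference model (`ModelD2`, all `Aᵢ = {0}`) has the DUALITY `(Bᵢ, Cᵢ) ↦ (−Cᵢ, −Bᵢ)`: the Def-5.1 word of the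
dual family at indices `(i, j, l)` is the word of the original family at `(l, j, i)` (`ModelD2.dual`).  Combined with the normal
form of `STPPSmallPatternKernelReflect122{,S}.lean` this halves the set of first-level starts `(y, c'₀)` a kernel search must
visit: `not_exists_isSTPP_122_of_search2x_dualF` asks, for every representative element `d` and every `z`, that EITHER `z` is
carried by a listed map fixing `d` into a code allowed by `d`'s chunks, OR the dual start — `−z` carried to a representative
`d*` by a listed covering map `f`, then `f (−d)` carried by a listed map fixing `d*` into a code allowed by `d*`'s chunks — is
searched.  Maps are plain functions (generator images); additivity, injectivity and the cover are kernel-decided per cell.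

References: H. Cohn, R. Kleinberg, B. Szegedy, C. Umans, FOCS 2005 (arXiv:math/0511460), Def. 5.1.
-/

namespace Summit.MatrixMultiplication.OmegaCensus

namespace STPP122Neg

open STPP211Neg Literature.Computability.AlgebraicComplexity

section Refl

variable {G : Type} [AddCommGroup G] {E : GEnc G} {K : ℕ} {b b' c c' : Fin K → G}

/-- **DUALITY** of the `(1,2,2)` difference model: `(Bᵢ, Cᵢ) ↦ (−Cᵢ, −Bᵢ)` preserves the model (the word at `(i, j, l)` of the
dual is the word at `(l, j, i)` of the original). -/
theorem ModelD2.dual (hM : ModelD2 b b' c c') :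
    ModelD2 (fun i => -c i) (fun i => -c' i) (fun i => -b i) (fun i => -b' i) := by
  have pullB : ∀ i x, InA (fun i => -c i) (fun i => -c' i) i x → ∃ u, InA c c' i u ∧ x = -u := by
    rintro i x (rfl | rfl)
    · exact ⟨c i, inA_p i, rfl⟩
    · exact ⟨c' i, inA_q i, rfl⟩
  have pullC : ∀ i x, InA (fun i => -b i) (fun i => -b' i) i x → ∃ t, InA b b' i t ∧ x = -t := by
    rintro i x (rfl | rfl)
    · exact ⟨b i, inA_p i, rfl⟩
    · exact ⟨b' i, inA_q i, rfl⟩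
  refine ⟨fun i h => hM.2.1 i (neg_injective h), fun i h => hM.1 i (neg_injective h),
    fun j t t' u u' ht ht' hu hu' h => ?_, fun i j l t t' u u' hijl ht ht' hu hu' h => ?_⟩
  · obtain ⟨u₀, hu₀, rfl⟩ := pullB j t ht
    obtain ⟨u₁, hu₁, rfl⟩ := pullB j t' ht'
    obtain ⟨t₀, ht₀, rfl⟩ := pullC j u hu
    obtain ⟨t₁, ht₁, rfl⟩ := pullC j u' hu'
    have h' : t₀ - u₁ = t₁ - u₀ := by
      have h2 : -u₁ - -t₀ = -u₀ - -t₁ := h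
      have h3 : t₀ - u₁ = -u₁ - -t₀ := by abel
      have h4 : t₁ - u₀ = -u₀ - -t₁ := by abel
      rw [h3, h4, h2]
    obtain ⟨e1, e2⟩ := hM.2.2.1 j t₁ t₀ u₁ u₀ ht₁ ht₀ hu₁ hu₀ h'
    exact ⟨by rw [e2], by rw [e1]⟩
  · obtain ⟨u₀, hu₀, rfl⟩ := pullB i t ht
    obtain ⟨u₁, hu₁, rfl⟩ := pullB j t' ht'
    obtain ⟨t₀, ht₀, rfl⟩ := pullC j u hu
    obtain ⟨t₁, ht₁, rfl⟩ := pullC l u' hu'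
    have hne := hM.2.2.2 l j i t₁ t₀ u₁ u₀ hijl.symm ht₁ ht₀ hu₁ hu₀
    apply hne
    have h3 : t₀ - u₁ = -u₁ - -t₀ := by abel
    have h4 : t₁ - u₀ = -u₀ - -t₁ := by abel
    rw [h3, h4]
    exact h

/-- NORMAL FORM TAIL: a model with `b₀ = c₀ = 0` can be oriented and sorted into `NF2` without changing the elements `b'₀`, `c'₀`
of triple `0` (orientation keeps index `0` because code `0` is minimal; sorting keeps it first). -/
theorem exists_NF2_fix0 (E : GEnc G) (hM : ModelD2 b b' c c') (hK : 0 < K) (hb0 : b ⟨0, hK⟩ = 0) (hc0 : c ⟨0, hK⟩ = 0) :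
    ∃ p p' q q' : Fin K → G, ModelD2 p p' q q' ∧ NF2 E p p' q q' ∧ p ⟨0, hK⟩ = 0 ∧ q ⟨0, hK⟩ = 0 ∧
      p' ⟨0, hK⟩ = b' ⟨0, hK⟩ ∧ q' ⟨0, hK⟩ = c' ⟨0, hK⟩ := by
  set i0 : Fin K := ⟨0, hK⟩
  set b2 : Fin K → G := fun i => if E.enc (b i) < E.enc (b' i) then b i else b' i
  set b2' : Fin K → G := fun i => if E.enc (b i) < E.enc (b' i) then b' i else b i
  set c2 : Fin K → G := fun i => if E.enc (c i) < E.enc (c' i) then c i else c' i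
  set c2' : Fin K → G := fun i => if E.enc (c i) < E.enc (c' i) then c' i else c i
  have hM2 : ModelD2 b2 b2' c2 c2' := hM.orient E
  have hB0 : E.enc (b i0) < E.enc (b' i0) := by
    rw [hb0, E.enc_zero]; refine Nat.pos_of_ne_zero fun h0 => hM.1 i0 ?_
    rw [hb0]; exact (E.enc_inj (h0.trans E.enc_zero.symm)).symm
  have hC0 : E.enc (c i0) < E.enc (c' i0) := by
    rw [hc0, E.enc_zero]; refine Nat.pos_of_ne_zero fun h0 => hM.2.1 i0 ?_
    rw [hc0]; exact (E.enc_inj (h0.trans E.enc_zero.symm)).symm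
  have hb2 : b2 i0 = 0 := by
    show (if E.enc (b i0) < E.enc (b' i0) then b i0 else b' i0) = 0
    rw [if_pos hB0, hb0]
  have hb2' : b2' i0 = b' i0 := by
    show (if E.enc (b i0) < E.enc (b' i0) then b' i0 else b i0) = _
    rw [if_pos hB0]
  have hc2 : c2 i0 = 0 := by
    show (if E.enc (c i0) < E.enc (c' i0) then c i0 else c' i0) = 0
    rw [if_pos hC0, hc0]
  have hc2' : c2' i0 = c' i0 := by
    show (if E.enc (c i0) < E.enc (c' i0) then c' i0 else c i0) = _
    rw [if_pos hC0]
  have hlt2 : ∀ i, E.enc (b2 i) < E.enc (b2' i) ∧ E.enc (c2 i) < E.enc (c2' i) := by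
    intro i
    have hne1 : E.enc (b i) ≠ E.enc (b' i) := fun e => hM.1 i (E.enc_inj e)
    have hne2 : E.enc (c i) ≠ E.enc (c' i) := fun e => hM.2.1 i (E.enc_inj e)
    constructor
    · show E.enc (if E.enc (b i) < E.enc (b' i) then b i else b' i) <
        E.enc (if E.enc (b i) < E.enc (b' i) then b' i else b i)
      split_ifs with h
      · exact h
      · omega
    · show E.enc (if E.enc (c i) < E.enc (c' i) then c i else c' i) <
        E.enc (if E.enc (c i) < E.enc (c' i) then c' i else c i)
      split_ifs with h
      · exact h
      · omega
  set σ := Tuple.sort (fun i => E.enc (b2 i))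
  have hmono : Monotone ((fun i => E.enc (b2 i)) ∘ σ) := Tuple.monotone_sort _
  have hM3 : ModelD2 (b2 ∘ σ) (b2' ∘ σ) (c2 ∘ σ) (c2' ∘ σ) := hM2.reindex σ σ.injective
  have hinjb : Function.Injective (fun i => E.enc ((b2 ∘ σ) i)) := by
    intro i j h
    have h' : b2 (σ i) = b2 (σ j) := E.enc_inj h
    have hin : InA b2 b2' (σ j) (b2 (σ i)) := by rw [h']; exact inA_p (σ j)
    exact σ.injective (hM2.b_disj (inA_p (σ i)) hin)
  have hsm : StrictMono (fun i => E.enc ((b2 ∘ σ) i)) := hmono.strictMono_of_injective hinjb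
  have hσ0 : σ i0 = i0 := by
    have hi0le : i0 ≤ σ.symm i0 := by rw [Fin.le_def]; exact Nat.zero_le _
    have hle : E.enc (b2 (σ i0)) ≤ E.enc (b2 (σ (σ.symm i0))) := hmono hi0le
    rw [Equiv.apply_symm_apply, hb2, E.enc_zero] at hle
    have h00 : E.enc ((b2 ∘ σ) i0) = E.enc ((b2 ∘ σ) (σ.symm i0)) := by
      show E.enc (b2 (σ i0)) = E.enc (b2 (σ (σ.symm i0))); rw [Equiv.apply_symm_apply, hb2, E.enc_zero]; omega
    have h3 := congrArg σ (hinjb h00)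
    rw [Equiv.apply_symm_apply] at h3
    exact h3
  refine ⟨b2 ∘ σ, b2' ∘ σ, c2 ∘ σ, c2' ∘ σ, hM3, ⟨fun i j hij => hsm hij, fun i => (hlt2 (σ i)).1, fun i => (hlt2 (σ i)).2⟩,
    ?_, ?_, ?_, ?_⟩
  · show b2 (σ i0) = 0; rw [hσ0, hb2]
  · show c2 (σ i0) = 0; rw [hσ0, hc2]
  · show b2' (σ i0) = b' i0; rw [hσ0, hb2']
  · show c2' (σ i0) = c' i0; rw [hσ0, hc2']

/-- **NORMAL FORM WITH STABILISER AND DUALITY REDUCTIONS**: for every representative element `d` and every `z`, either a listed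
map fixing `d` carries `z` into `good (enc d)`, or the DUAL start is good: a listed covering map `f` carries `−z` to a
representative `d* = f (−z)` and a listed map fixing `d*` carries `f (−d)` into `good (enc d*)`.  Then every model has a normal
form whose start `(b'₀, c'₀)` is good. -/
theorem exists_normalForm2_dual (E : GEnc G) (hM : ModelD2 b b' c c') (hK : 0 < K) {dlist : List ℕ}
    {auts : List (G →+ G)} (hinj : ∀ f ∈ auts, Function.Injective f)
    (hcover : ∀ d : G, d ≠ 0 → ∃ f ∈ auts, E.enc (f d) ∈ dlist)
    {stabs : List (G →+ G)} (hsinj : ∀ f ∈ stabs, Function.Injective f) {good : ℕ → ℕ → Prop}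
    (hgood : ∀ d : G, E.enc d ∈ dlist → ∀ z : G,
      (∃ g ∈ stabs, g d = d ∧ good (E.enc d) (E.enc (g z))) ∨
      (∃ f ∈ auts, E.enc (f (-z)) ∈ dlist ∧ ∃ g ∈ stabs, g (f (-z)) = f (-z) ∧ good (E.enc (f (-z))) (E.enc (g (f (-d)))))) :
    ∃ p p' q q' : Fin K → G, ModelD2 p p' q q' ∧ NF2 E p p' q q' ∧ p ⟨0, hK⟩ = 0 ∧ q ⟨0, hK⟩ = 0 ∧
      E.enc (p' ⟨0, hK⟩) ∈ dlist ∧ good (E.enc (p' ⟨0, hK⟩)) (E.enc (q' ⟨0, hK⟩)) := by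
  set i0 : Fin K := ⟨0, hK⟩
  obtain ⟨p, p', q, q', hMp, -, hp0, hq0, hd⟩ := exists_normalForm2 E hM hK hinj hcover
  rcases hgood (p' i0) hd (q' i0) with ⟨g, hg, hgd, hgz⟩ | ⟨f, hf, hfd, g, hg, hgd, hgz⟩
  · -- stabiliser case: apply `g`
    have hM1 : ModelD2 (fun i => g (p i)) (fun i => g (p' i)) (fun i => g (q i)) (fun i => g (q' i)) :=
      hMp.map g (hsinj g hg)
    obtain ⟨r, r', s, s', hMr, hNF, hr0, hs0, hr', hs'⟩ := exists_NF2_fix0 E hM1 hK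
      (by show g (p i0) = 0; rw [show p i0 = 0 from hp0, map_zero]) (by show g (q i0) = 0; rw [show q i0 = 0 from hq0, map_zero])
    refine ⟨r, r', s, s', hMr, hNF, hr0, hs0, ?_, ?_⟩
    · rw [hr']; show E.enc (g (p' i0)) ∈ dlist; rw [hgd]; exact hd
    · rw [hr', hs']; show good (E.enc (g (p' i0))) (E.enc (g (q' i0))); rw [hgd]; exact hgz
  · -- dual case: dualise, apply `f`, then `g`
    have hMd := hMp.dual
    have hM1 : ModelD2 (fun i => g (f (-q i))) (fun i => g (f (-q' i))) (fun i => g (f (-p i))) (fun i => g (f (-p' i))) :=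
      (hMd.map f (hinj f hf)).map g (hsinj g hg)
    obtain ⟨r, r', s, s', hMr, hNF, hr0, hs0, hr', hs'⟩ := exists_NF2_fix0 E hM1 hK
      (by show g (f (-q i0)) = 0; rw [show q i0 = 0 from hq0, neg_zero, map_zero, map_zero])
      (by show g (f (-p i0)) = 0; rw [show p i0 = 0 from hp0, neg_zero, map_zero, map_zero])
    refine ⟨r, r', s, s', hMr, hNF, hr0, hs0, ?_, ?_⟩
    · rw [hr']; show E.enc (g (f (-q' i0))) ∈ dlist; rw [hgd]; exact hfd
    · rw [hr', hs']; show good (E.enc (g (f (-q' i0)))) (E.enc (g (f (-p' i0)))); rw [hgd]; exact hgz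

/-- **REFLECTION THROUGH DEF. 5.1, chunked search, stabiliser + duality cover — FUNCTION-LIST FORM** (pattern `(1,2,2)^k`).
[cite: CohnKleinbergSzegedyUmans2005, Def. 5.1] -/
theorem not_exists_isSTPP_122_of_search2x_dualF [DecidableEq G] (E : GEnc G) (hK : 0 < K) {chunks : List (ℕ × ℕ)}
    (hsearch : search2x E.g K chunks = true) {reps : List ℕ} {auts : List (G → G)}
    (hadd : ∀ f ∈ auts, ∀ a b : G, f (a + b) = f a + f b) (hinj : ∀ f ∈ auts, Function.Injective f)
    (hcover : ∀ d : G, d ≠ 0 → ∃ f ∈ auts, E.enc (f d) ∈ reps)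
    {stabs : List (G → G)} (hsadd : ∀ f ∈ stabs, ∀ a b : G, f (a + b) = f a + f b)
    (hsinj : ∀ f ∈ stabs, Function.Injective f)
    (hchunks : ∀ d : G, E.enc d ∈ reps → ∀ z : G,
      (∃ g ∈ stabs, g d = d ∧ ∃ e ∈ chunks, e.1 = E.enc d ∧ e.2.testBit (E.enc (g z)) = false) ∨
      (∃ f ∈ auts, E.enc (f (-z)) ∈ reps ∧ ∃ g ∈ stabs, g (f (-z)) = f (-z) ∧
        ∃ e ∈ chunks, e.1 = E.enc (f (-z)) ∧ e.2.testBit (E.enc (g (f (-d)))) = false)) :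
    ¬ ∃ A B C : Fin K → Finset G, IsSTPP A B C ∧ ∀ i, (A i).card = 1 ∧ (B i).card = 2 ∧ (C i).card = 2 := by
  rw [exists_isSTPP_122_iff]
  rintro ⟨p, p', q, q', hb, hc, hU, hX⟩
  have hM : ModelD2 p p' q q' := modelD2_of_finsetForm hb hc hU hX
  -- assemble the hom lists
  set LA : List (G →+ G) := auts.attach.map fun x => AddMonoidHom.mk' x.1 (hadd x.1 x.2)
  set LS : List (G →+ G) := stabs.attach.map fun x => AddMonoidHom.mk' x.1 (hsadd x.1 x.2)
  have hinjA : ∀ φ ∈ LA, Function.Injective φ := fun φ hφ => by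
    obtain ⟨f, hf, hφf⟩ := coe_mem_of_mem_attach_map hφ
    rw [hφf]; exact hinj f hf
  have hinjS : ∀ φ ∈ LS, Function.Injective φ := fun φ hφ => by
    obtain ⟨f, hf, hφf⟩ := coe_mem_of_mem_attach_map hφ
    rw [hφf]; exact hsinj f hf
  have hcoverA : ∀ d : G, d ≠ 0 → ∃ φ ∈ LA, E.enc (φ d) ∈ reps := fun d hd => by
    obtain ⟨f, hf, hfd⟩ := hcover d hd
    obtain ⟨φ, hφ, hφf⟩ := exists_mem_attach_map hadd hf
    exact ⟨φ, hφ, by rw [hφf]; exact hfd⟩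
  obtain ⟨r, r', s, s', hMr, hNF, hr0, hs0, -, e, he, h1, h2⟩ := exists_normalForm2_dual E hM hK hinjA hcoverA hinjS
    (good := fun y z => ∃ e ∈ chunks, e.1 = y ∧ e.2.testBit z = false) (fun d hd z => by
      rcases hchunks d hd z with ⟨g, hg, hgd, hrest⟩ | ⟨f, hf, hfd, g, hg, hgd, hrest⟩
      · obtain ⟨ψ, hψ, hψg⟩ := exists_mem_attach_map hsadd hg
        exact Or.inl ⟨ψ, hψ, by rw [hψg]; exact hgd, by rw [hψg]; exact hrest⟩
      · obtain ⟨φ, hφ, hφf⟩ := exists_mem_attach_map hadd hf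
        obtain ⟨ψ, hψ, hψg⟩ := exists_mem_attach_map hsadd hg
        refine Or.inr ⟨φ, hφ, by rw [hφf]; exact hfd, ψ, hψ, by rw [hψg, hφf]; exact hgd, ?_⟩
        rw [hψg, hφf]; exact hrest)
  have := start2x_of_search2x hsearch e he
  obtain ⟨y, x1⟩ := e
  simp only at h1 h2
  subst h1
  rw [start2x_false hMr hNF hK hr0 hs0 h2] at this
  exact Bool.false_ne_true this

end Refl

end STPP122Neg

end Summit.MatrixMultiplication.OmegaCensus
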